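import Mathlib
import HarnessLib
import Summits.CriticalPhenomena.SAWScalingLimit.Theses.SAWDevelopingMap
import Literature.Probability.RandomPlanarGeometry.HexSAW
import Literature.Probability.RandomPlanarGeometry.RestrictionHulls
import Literature.Probability.RandomPlanarGeometry.ConformalRectangle

/-!
# Sketch — crux-idea `coalescent-arc-restriction` for crux `ObservableToSLE`
(stmt-CriticalPhenomena-10472). First lemma (SL′) `ArcLocality` and the typed waypoint
`RestrictionCocycleLimit`; `K1Shape` is the shape of the load-bearing implication.
Nothing is proved here; the point is that the statements elaborate over existing declarations.
-/

namespace Summit.CriticalPhenomena.SAWScalingLimit.Cruxes.ObservableToSLE.CoalescentArcRestriction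

open Filter Topology MeasureTheory Set
open Literature.Probability.LatticeModels Literature.Probability.RandomPlanarGeometry
open Literature.Probability.RandomPlanarGeometry.SAW

/-- **(SL′) Arc locality — short boundary arcs of the critical hexagonal SAW do not wander.**
`Ω` is a bounded open set which is FLAT near the boundary point `a` (inside `B(a, ρ)` it is the open
upper half-disc), `Ω' ⊆ Ω` is any open subset that agrees with `Ω` inside `B(a, ρ)`. Then for every
`ε > 0`, for all real `s ≠ 0` close enough to `0`, for all lattice endpoints `a_δ → a`,
`s_δ → a + s` joined in `Ω'_δ` eventually: eventually in `δ → 0⁺`,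
`(1 - ε) · Z_{Ω_δ}(a_δ, s_δ) ≤ Z_{Ω'_δ}(a_δ, s_δ)` — i.e. the critical SAW of `Ω_δ` between two
boundary points at mutual distance `|s|` leaves the common neighbourhood (in particular: reaches the
region where `Ω` and `Ω'` differ) with probability `≤ ε`, uniformly in the mesh. `Z` is the total mass
of `hexSAWWeight` (weights `x_c^{ℓ(γ)}`). Phase-free, positive, monotone in `Ω'`. -/
def ArcLocality : Prop :=
  ∀ (Ω Ω' : Set ℂ) (a : ℂ) (ρ : ℝ), IsOpen Ω → IsOpen Ω' → Bornology.IsBounded Ω → Ω' ⊆ Ω →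
    0 < ρ → Ω ∩ Metric.ball a ρ = {z : ℂ | a.im < z.im} ∩ Metric.ball a ρ →
    Ω' ∩ Metric.ball a ρ = Ω ∩ Metric.ball a ρ →
    ∀ ε : ℝ, 0 < ε → ∀ᶠ s : ℝ in 𝓝[≠] 0, ∀ (aδ sδ : ℝ → HexVertex),
      Tendsto (fun δ : ℝ => (δ : ℂ) * hexCenter (aδ δ)) (𝓝[>] 0) (𝓝 a) →
      Tendsto (fun δ : ℝ => (δ : ℂ) * hexCenter (sδ δ)) (𝓝[>] 0) (𝓝 (a + s)) →
      (∀ᶠ δ : ℝ in 𝓝[>] 0, (hexDomainGraph Ω' δ).Reachable (aδ δ) (sδ δ)) →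
      ∀ᶠ δ : ℝ in 𝓝[>] 0,
        ENNReal.ofReal (1 - ε) * hexSAWWeight Ω δ (aδ δ) (sδ δ) Set.univ
          ≤ hexSAWWeight Ω' δ (aδ δ) (sδ δ) Set.univ

/-- **Waypoint — the restriction cocycle of the critical hexagonal SAW (flat class, boundary-vertex
endpoints).** For a Dobrushin domain `(D; a, b)` flat near `a` and near `b`, a chordal uniformizer
`φ : (ℍ; 0, ∞) → (D; a, b)`, a `*`-hull `A ⊆ ℍ̄` with restriction map `Φ_A` and `Φ'_A(0) = d`, and the
hull sub-domain `D' = φ(ℍ ∖ A)` (same marked points, agreeing with `D` near `a`, `b`), the exact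
lattice restriction identity `P^{D}_δ(γ ⊂ D') = Z_{D'_δ}(a_δ,b_δ)/Z_{D_δ}(a_δ,b_δ)` has the SLE_{8/3}
value in the limit: `Z_{D'_δ}/Z_{D_δ} → Φ'_A(0)^{5/8}` ([LSW03] Thm 6.1 is the matching statement for
SLE_{8/3}: `sle_restriction_eightThirds`), for lattice endpoints that are inner vertices of boundary
mid-edges on the flat pieces. -/
def RestrictionCocycleLimit : Prop :=
  ∀ (D D' : DobrushinDomain) (φ : ConformalEquiv UpperHalfPlane.upperHalfPlaneSet D.carrier)
    (A : Set ℂ)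
    (Φ : ConformalEquiv (UpperHalfPlane.upperHalfPlaneSet \ A) UpperHalfPlane.upperHalfPlaneSet)
    (d ρ : ℝ),
    D.IsChordalUniformizing φ → IsStarHull A → IsRestrictionMap A Φ → HasRestrictionDeriv A Φ d →
    D'.carrier = φ '' (UpperHalfPlane.upperHalfPlaneSet \ A) → D'.pt 0 = D.pt 0 → D'.pt 1 = D.pt 1 →
    0 < ρ →
    D.carrier ∩ Metric.ball (D.pt 0) ρ = {z : ℂ | (D.pt 0).im < z.im} ∩ Metric.ball (D.pt 0) ρ →
    D.carrier ∩ Metric.ball (D.pt 1) ρ = {z : ℂ | (D.pt 1).im < z.im} ∩ Metric.ball (D.pt 1) ρ →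
    D'.carrier ∩ Metric.ball (D.pt 0) ρ = D.carrier ∩ Metric.ball (D.pt 0) ρ →
    D'.carrier ∩ Metric.ball (D.pt 1) ρ = D.carrier ∩ Metric.ball (D.pt 1) ρ →
    ∀ (aδ bδ : ℝ → HexVertex), IsEmbEndpointApprox hexGraph hexCenter D' aδ bδ →
      (∀ᶠ δ : ℝ in 𝓝[>] 0,
        (∃ u, hexGraph.Adj (aδ δ) u ∧ ((δ : ℂ) * hexCenter u).im ≤ (D.pt 0).im) ∧
        (∃ u, hexGraph.Adj (bδ δ) u ∧ ((δ : ℂ) * hexCenter u).im ≤ (D.pt 1).im)) →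
      Tendsto (fun δ : ℝ =>
          (hexSAWWeight D'.carrier δ (aδ δ) (bδ δ) Set.univ).toReal /
            (hexSAWWeight D.carrier δ (aδ δ) (bδ δ) Set.univ).toReal)
        (𝓝[>] 0) (𝓝 (d ^ ((5 : ℝ) / 8)))

/-- Shape of the load-bearing implication (stub K1 of the card plus the discretisation glue K3(i):
`HexObservableLimit` speaks about ADMISSIBLE discretisation families `Λ_δ` with flat zigzag rows near
the normalisation point, `RestrictionCocycleLimit` about the canonical `Ω_δ` of `hexSAWLaw`): the crux
hypothesis `HexObservableLimit` (DCS Conjecture 2, ψ-averaged, normalised at a flat `b`) and arc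
locality give the restriction cocycle. -/
def K1Shape : Prop :=
  Summit.CriticalPhenomena.SAWScalingLimit.Theses.SAWDevelopingMap.HexObservableLimit →
    ArcLocality → RestrictionCocycleLimit

end Summit.CriticalPhenomena.SAWScalingLimit.Cruxes.ObservableToSLE.CoalescentArcRestriction
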